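import Literature.AlgebraicGeometry.RelativeSpec.SymmetricPower
import HarnessLib

/-!
# Fibre powers commute with base change of the base: `(P ×_S B)ⁿ_B = Pⁿ_S ×_S B`

Topic `Literature/AlgebraicGeometry/RelativeSpec`, namespace `Literature.AlgebraicGeometry.RelativeSpec` (sequel of ★ `SymmetricPower`: `powOver r n` = the
`n`-fold fibre power `Xⁿ_Y` of `r : X → Y`, Mathlib `widePullback`).  THEOREMS ONLY (no definition, no instance, no notation, no `sorry`).

[StacksProject, Tag 01JO ∕ 01JA] (fibre products commute with base change; «limits commute with limits»): for `f : P → S`, `b : B → S` and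
`f′ := pr₂ : P ×_S B → B`, the COMPARISON MAP `(P ×_S B)ⁿ_B → Pⁿ_S`, `(x_k)_k ↦ (pr₁ x_k)_k` over `base ≫ b` (spelled inline as Mathlib
`WidePullback.lift`, no definition), together with `base : (P ×_S B)ⁿ_B → B`, is a CARTESIAN square over `(base : Pⁿ_S → S, b)`:
`(P ×_S B)ⁿ_B ≅ Pⁿ_S ×_S B`, naturally in the projections.

* `powOver_baseChange_lift_base`, `powOver_baseChange_lift_proj` — the comparison map lies over `base ≫ b` and commutes with the `k`-th projections;
* **`isPullback_powOver_snd`** — the square `((P ×_S B)ⁿ_B → Pⁿ_S, base, base, b)` is cartesian (universal property checked by hand: a cone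
  `(u : T → Pⁿ_S, v : T → B)` factors through `WidePullback.lift v (k ↦ (u ≫ pr_k, v))`, uniquely by `WidePullback.hom_ext` + `pullback.hom_ext`);
* `exists_isPullback_powOver_snd` — the `∃`-packaged form (comparison map with its two compatibilities and the cartesian square);
* §2 the same three facts with the base change spelled `pullback.fst b f : B ×_S P → B` (`isPullback_powOver_fst`, …) — the spelling of
  ★ `Morphisms.projectiveSpace ι T = T ×_⊤ 𝐏ⁿ_ℤ`, `projectiveSpaceFst = pullback.fst`: `𝐏(ι; T)ⁿ_T = (𝐏ⁿ_ℤ)ⁿ × T`;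
* §3 the same over an arbitrary CARTESIAN SQUARE `sq : IsPullback b′ f′ f b` (no literal `pullback` term — the consumer shape of B-p11 (g20)'s
  (B1c), whose square `𝐏(J; H₁′) → 𝐏ⁿ_ℚ` over `H₁′ → Spec ℚ` is cut from ★ `ProjBaseChangeRing.isPullback_projMap`): **`isPullback_powOver_lift`**,
  `exists_isPullback_powOver_of_isPullback`, `powOver_hom_ext_of_isPullback` (universal property by `sq.lift` ∕ `sq.hom_ext`).

Cell hodgecm-mathlib (D-0151 ∕ FLOOR 0), P1 sub-line F-13, LACK W3 of B-p11 (g20)'s P4 FILE B roadfile v2 (the plumbing heart of the immersion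
`H ↪ (𝐏^m)^{×n} × 𝐏^M`: `𝐏(J; H₁′)ⁿ_{H₁′} = (𝐏ⁿ_ℤ)ⁿ × H₁′`).  PROOF lane, count-neutral generic capital.  HC_CM is proved only modulo the 7 printed
citations until rung 0 closes; nothing here is about HC.

## References
* [StacksProject] The Stacks Project, Tag 01JO (base change of fibre products), Tag 01JA (fibre products of schemes), Tag 002S (limits commute with limits).
* [MumfordFogartyKirwan1994] D. Mumford, J. Fogarty, F. Kirwan, *Geometric Invariant Theory*, 3rd ed. (1994), Ch. 7 §2, proof of Prop. 7.3 (p. 132)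
  (the fibre power `Z × ⋯ × Z` of the universal family and its base changes).
-/

noncomputable section

universe u

open CategoryTheory CategoryTheory.Limits AlgebraicGeometry

namespace Literature.AlgebraicGeometry.RelativeSpec

variable {P S B : Scheme.{u}} (f : P ⟶ S) (b : B ⟶ S) (n : ℕ)

/-- The components `pr_k ≫ pr₁ : (P ×_S B)ⁿ_B → P` of the comparison map lie over `base ≫ b` (so that `WidePullback.lift` applies).
[cite: StacksProject, Tag 01JO] -/
theorem powOver_proj_fst_comp (k : Fin n) :
    (powOver.proj (pullback.snd f b) n k ≫ pullback.fst f b) ≫ f = powOver.base (pullback.snd f b) n ≫ b := by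
  rw [Category.assoc, pullback.condition, ← Category.assoc, WidePullback.π_arrow]

/-- **The comparison map lies over `base ≫ b`**: `((P ×_S B)ⁿ_B → Pⁿ_S) ≫ base = base ≫ b`. [cite: StacksProject, Tag 01JO] -/
theorem powOver_baseChange_lift_base :
    WidePullback.lift (objs := fun _ : Fin n => P) (arrows := fun _ => f) (powOver.base (pullback.snd f b) n ≫ b)
        (fun k => powOver.proj (pullback.snd f b) n k ≫ pullback.fst f b) (powOver_proj_fst_comp f b n) ≫
      powOver.base f n = powOver.base (pullback.snd f b) n ≫ b :=
  WidePullback.lift_base _ _ _ _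

/-- **The comparison map commutes with the projections**: `((P ×_S B)ⁿ_B → Pⁿ_S) ≫ pr_k = pr_k ≫ pr₁`. [cite: StacksProject, Tag 01JO] -/
theorem powOver_baseChange_lift_proj (k : Fin n) :
    WidePullback.lift (objs := fun _ : Fin n => P) (arrows := fun _ => f) (powOver.base (pullback.snd f b) n ≫ b)
        (fun k => powOver.proj (pullback.snd f b) n k ≫ pullback.fst f b) (powOver_proj_fst_comp f b n) ≫
      powOver.proj f n k = powOver.proj (pullback.snd f b) n k ≫ pullback.fst f b :=
  WidePullback.lift_π _ _ _ _ k

/-- **Fibre powers commute with base change of the base: `(P ×_S B)ⁿ_B = Pⁿ_S ×_S B`.**  The square with top the comparison map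
`(P ×_S B)ⁿ_B → Pⁿ_S`, left `base : (P ×_S B)ⁿ_B → B`, right `base : Pⁿ_S → S`, bottom `b` is cartesian.  (A cone `(u : T → Pⁿ_S, v : T → B)`,
`u ≫ base = v ≫ b`, factors through `WidePullback.lift v (k ↦ pullback.lift (u ≫ pr_k) v _)`; uniqueness by `WidePullback.hom_ext` and
`pullback.hom_ext`.) [cite: StacksProject, Tag 01JO] [cite: StacksProject, Tag 002S] [cite: MumfordFogartyKirwan1994, Ch. 7 §2, proof of Prop. 7.3 (p. 132)] -/
theorem isPullback_powOver_snd :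
    IsPullback
      (WidePullback.lift (objs := fun _ : Fin n => P) (arrows := fun _ => f) (powOver.base (pullback.snd f b) n ≫ b)
        (fun k => powOver.proj (pullback.snd f b) n k ≫ pullback.fst f b) (powOver_proj_fst_comp f b n))
      (powOver.base (pullback.snd f b) n) (powOver.base f n) b := by
  refine IsPullback.of_isLimit' ⟨powOver_baseChange_lift_base f b n⟩ (PullbackCone.IsLimit.mk _ ?lift ?facl ?facr ?uniq)
  · -- the lift of a cone `(u, v)`
    intro s
    exact WidePullback.lift (objs := fun _ : Fin n => pullback f b) (arrows := fun _ => pullback.snd f b) s.snd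
      (fun k => pullback.lift (s.fst ≫ powOver.proj f n k) s.snd
        (by rw [Category.assoc, WidePullback.π_arrow]; exact s.condition))
      (fun k => pullback.lift_snd _ _ _)
  · -- `lift ≫ comparison = u`
    intro s
    apply WidePullback.hom_ext
    · intro k
      rw [Category.assoc, powOver_baseChange_lift_proj, ← Category.assoc, WidePullback.lift_π, pullback.lift_fst]
    · rw [Category.assoc, powOver_baseChange_lift_base, ← Category.assoc, WidePullback.lift_base]
      exact s.condition.symm
  · -- `lift ≫ base = v`
    intro s
    exact WidePullback.lift_base _ _ _ _
  · -- uniqueness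
    intro s m hm₁ hm₂
    apply WidePullback.hom_ext
    · intro k
      rw [WidePullback.lift_π]
      apply pullback.hom_ext
      · rw [Category.assoc, pullback.lift_fst, ← powOver_baseChange_lift_proj f b n k, ← Category.assoc, hm₁]
      · rw [Category.assoc, pullback.lift_snd, WidePullback.π_arrow]
        exact hm₂
    · rw [WidePullback.lift_base]
      exact hm₂

/-- **`∃`-packaged form**: a comparison map `c : (P ×_S B)ⁿ_B → Pⁿ_S` with `c ≫ base = base ≫ b`, `c ≫ pr_k = pr_k ≫ pr₁` for all `k`, and
`(c, base, base, b)` cartesian. [cite: StacksProject, Tag 01JO] -/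
theorem exists_isPullback_powOver_snd :
    ∃ c : powOver (pullback.snd f b) n ⟶ powOver f n,
      c ≫ powOver.base f n = powOver.base (pullback.snd f b) n ≫ b ∧
      (∀ k, c ≫ powOver.proj f n k = powOver.proj (pullback.snd f b) n k ≫ pullback.fst f b) ∧
      IsPullback c (powOver.base (pullback.snd f b) n) (powOver.base f n) b :=
  ⟨_, powOver_baseChange_lift_base f b n, powOver_baseChange_lift_proj f b n, isPullback_powOver_snd f b n⟩

/-- **Points form**: two morphisms `T → (P ×_S B)ⁿ_B` agree as soon as they agree after `base` and after each `pr_k ≫ pr₁`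
(the comparison map and `base` are jointly monic). [cite: StacksProject, Tag 01JO] -/
theorem powOver_snd_hom_ext {T : Scheme.{u}} (g₁ g₂ : T ⟶ powOver (pullback.snd f b) n)
    (hbase : g₁ ≫ powOver.base (pullback.snd f b) n = g₂ ≫ powOver.base (pullback.snd f b) n)
    (hproj : ∀ k, g₁ ≫ powOver.proj (pullback.snd f b) n k ≫ pullback.fst f b = g₂ ≫ powOver.proj (pullback.snd f b) n k ≫ pullback.fst f b) :
    g₁ = g₂ := by
  apply WidePullback.hom_ext
  · intro k
    apply pullback.hom_ext
    · simpa only [Category.assoc] using hproj k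
    · rw [Category.assoc, Category.assoc, WidePullback.π_arrow]
      exact hbase
  · exact hbase

/-! ## §2 The same with the base change written as `pullback.fst b f : B ×_S P → B` (e.g. `𝐏(ι; T) = T ×_⊤ 𝐏ⁿ_ℤ → T`) -/

/-- The components `pr_k ≫ pr₂ : (B ×_S P)ⁿ_B → P` lie over `base ≫ b`. [cite: StacksProject, Tag 01JO] -/
theorem powOver_proj_snd_comp (k : Fin n) :
    (powOver.proj (pullback.fst b f) n k ≫ pullback.snd b f) ≫ f = powOver.base (pullback.fst b f) n ≫ b := by
  rw [Category.assoc, ← pullback.condition, ← Category.assoc, WidePullback.π_arrow]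

/-- The comparison map `(B ×_S P)ⁿ_B → Pⁿ_S` lies over `base ≫ b`. [cite: StacksProject, Tag 01JO] -/
theorem powOver_baseChange_lift_base' :
    WidePullback.lift (objs := fun _ : Fin n => P) (arrows := fun _ => f) (powOver.base (pullback.fst b f) n ≫ b)
        (fun k => powOver.proj (pullback.fst b f) n k ≫ pullback.snd b f) (powOver_proj_snd_comp f b n) ≫
      powOver.base f n = powOver.base (pullback.fst b f) n ≫ b :=
  WidePullback.lift_base _ _ _ _

/-- The comparison map `(B ×_S P)ⁿ_B → Pⁿ_S` commutes with the projections: `c ≫ pr_k = pr_k ≫ pr₂`. [cite: StacksProject, Tag 01JO] -/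
theorem powOver_baseChange_lift_proj' (k : Fin n) :
    WidePullback.lift (objs := fun _ : Fin n => P) (arrows := fun _ => f) (powOver.base (pullback.fst b f) n ≫ b)
        (fun k => powOver.proj (pullback.fst b f) n k ≫ pullback.snd b f) (powOver_proj_snd_comp f b n) ≫
      powOver.proj f n k = powOver.proj (pullback.fst b f) n k ≫ pullback.snd b f :=
  WidePullback.lift_π _ _ _ _ k

/-- **`(B ×_S P)ⁿ_B = Pⁿ_S ×_S B`** (the `pullback.fst` spelling of `isPullback_powOver_snd`): the square
`((B ×_S P)ⁿ_B → Pⁿ_S, base, base, b)` is cartesian — e.g. `𝐏(ι; T)ⁿ_T = (𝐏ⁿ_ℤ)ⁿ × T` for `𝐏(ι; T) = T ×_⊤ 𝐏ⁿ_ℤ`.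
[cite: StacksProject, Tag 01JO] [cite: StacksProject, Tag 002S] [cite: MumfordFogartyKirwan1994, Ch. 7 §2, proof of Prop. 7.3 (p. 132)] -/
theorem isPullback_powOver_fst :
    IsPullback
      (WidePullback.lift (objs := fun _ : Fin n => P) (arrows := fun _ => f) (powOver.base (pullback.fst b f) n ≫ b)
        (fun k => powOver.proj (pullback.fst b f) n k ≫ pullback.snd b f) (powOver_proj_snd_comp f b n))
      (powOver.base (pullback.fst b f) n) (powOver.base f n) b := by
  refine IsPullback.of_isLimit' ⟨powOver_baseChange_lift_base' f b n⟩ (PullbackCone.IsLimit.mk _ ?lift ?facl ?facr ?uniq)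
  · intro s
    exact WidePullback.lift (objs := fun _ : Fin n => pullback b f) (arrows := fun _ => pullback.fst b f) s.snd
      (fun k => pullback.lift s.snd (s.fst ≫ powOver.proj f n k)
        (by rw [Category.assoc, WidePullback.π_arrow]; exact s.condition.symm))
      (fun k => pullback.lift_fst _ _ _)
  · intro s
    apply WidePullback.hom_ext
    · intro k
      rw [Category.assoc, powOver_baseChange_lift_proj', ← Category.assoc, WidePullback.lift_π, pullback.lift_snd]
    · rw [Category.assoc, powOver_baseChange_lift_base', ← Category.assoc, WidePullback.lift_base]
      exact s.condition.symm
  · intro s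
    exact WidePullback.lift_base _ _ _ _
  · intro s m hm₁ hm₂
    apply WidePullback.hom_ext
    · intro k
      rw [WidePullback.lift_π]
      apply pullback.hom_ext
      · rw [Category.assoc, pullback.lift_fst, WidePullback.π_arrow]
        exact hm₂
      · rw [Category.assoc, pullback.lift_snd, ← powOver_baseChange_lift_proj' f b n k, ← Category.assoc, hm₁]
    · rw [WidePullback.lift_base]
      exact hm₂

/-- `∃`-packaged form of `isPullback_powOver_fst`. [cite: StacksProject, Tag 01JO] -/
theorem exists_isPullback_powOver_fst :
    ∃ c : powOver (pullback.fst b f) n ⟶ powOver f n,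
      c ≫ powOver.base f n = powOver.base (pullback.fst b f) n ≫ b ∧
      (∀ k, c ≫ powOver.proj f n k = powOver.proj (pullback.fst b f) n k ≫ pullback.snd b f) ∧
      IsPullback c (powOver.base (pullback.fst b f) n) (powOver.base f n) b :=
  ⟨_, powOver_baseChange_lift_base' f b n, powOver_baseChange_lift_proj' f b n, isPullback_powOver_fst f b n⟩

/-- Points form for the `pullback.fst` spelling: two morphisms `T → (B ×_S P)ⁿ_B` agree as soon as they agree after `base` and after each
`pr_k ≫ pr₂`. [cite: StacksProject, Tag 01JO] -/
theorem powOver_fst_hom_ext {T : Scheme.{u}} (g₁ g₂ : T ⟶ powOver (pullback.fst b f) n)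
    (hbase : g₁ ≫ powOver.base (pullback.fst b f) n = g₂ ≫ powOver.base (pullback.fst b f) n)
    (hproj : ∀ k, g₁ ≫ powOver.proj (pullback.fst b f) n k ≫ pullback.snd b f = g₂ ≫ powOver.proj (pullback.fst b f) n k ≫ pullback.snd b f) :
    g₁ = g₂ := by
  apply WidePullback.hom_ext
  · intro k
    apply pullback.hom_ext
    · rw [Category.assoc, Category.assoc, WidePullback.π_arrow]
      exact hbase
    · simpa only [Category.assoc] using hproj k
  · exact hbase

/-! ## §3 The same over an arbitrary CARTESIAN SQUARE (input `IsPullback b′ f′ f b`, no literal `pullback` term) -/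

section Square

variable {P S P' S' : Scheme.{u}} {f : P ⟶ S} {b : S' ⟶ S} {f' : P' ⟶ S'} {b' : P' ⟶ P} (sq : IsPullback b' f' f b) (n : ℕ)

include sq in
/-- The components `pr_k ≫ b′ : (P′)ⁿ_{S′} → P` lie over `base ≫ b`. [cite: StacksProject, Tag 01JO] -/
theorem powOver_proj_comp_of_isPullback (k : Fin n) :
    (powOver.proj f' n k ≫ b') ≫ f = powOver.base f' n ≫ b := by
  rw [Category.assoc, sq.w, ← Category.assoc, WidePullback.π_arrow]

/-- The comparison map `(P′)ⁿ_{S′} → Pⁿ_S` of a cartesian square lies over `base ≫ b`. [cite: StacksProject, Tag 01JO] -/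
theorem powOver_lift_base_of_isPullback :
    WidePullback.lift (objs := fun _ : Fin n => P) (arrows := fun _ => f) (powOver.base f' n ≫ b)
        (fun k => powOver.proj f' n k ≫ b') (powOver_proj_comp_of_isPullback sq n) ≫
      powOver.base f n = powOver.base f' n ≫ b :=
  WidePullback.lift_base _ _ _ _

/-- The comparison map `(P′)ⁿ_{S′} → Pⁿ_S` commutes with the projections: `c ≫ pr_k = pr_k ≫ b′`. [cite: StacksProject, Tag 01JO] -/
theorem powOver_lift_proj_of_isPullback (k : Fin n) :
    WidePullback.lift (objs := fun _ : Fin n => P) (arrows := fun _ => f) (powOver.base f' n ≫ b)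
        (fun k => powOver.proj f' n k ≫ b') (powOver_proj_comp_of_isPullback sq n) ≫
      powOver.proj f n k = powOver.proj f' n k ≫ b' :=
  WidePullback.lift_π _ _ _ _ k

/-- **Fibre powers of a cartesian square form a cartesian square**: if `(b′, f′, f, b)` is cartesian (`P′ = P ×_S S′` abstractly — e.g.
`𝐏(ι; T) → 𝐏ⁿ_A` over `T → Spec A`, cut from ★ `ProjBaseChangeRing.isPullback_projMap`), then so is
`((P′)ⁿ_{S′} → Pⁿ_S, base, base, b)`: `(P′)ⁿ_{S′} = Pⁿ_S ×_S S′`.  (Universal property by hand with `sq.lift` ∕ `sq.hom_ext`; the iso and its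
compatibilities are then `(…).isoPullback`.) [cite: StacksProject, Tag 01JO] [cite: StacksProject, Tag 002S]
[cite: MumfordFogartyKirwan1994, Ch. 7 §2, proof of Prop. 7.3 (p. 132)] -/
theorem isPullback_powOver_lift :
    IsPullback
      (WidePullback.lift (objs := fun _ : Fin n => P) (arrows := fun _ => f) (powOver.base f' n ≫ b)
        (fun k => powOver.proj f' n k ≫ b') (powOver_proj_comp_of_isPullback sq n))
      (powOver.base f' n) (powOver.base f n) b := by
  refine IsPullback.of_isLimit' ⟨powOver_lift_base_of_isPullback sq n⟩ (PullbackCone.IsLimit.mk _ ?lift ?facl ?facr ?uniq)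
  · intro s
    exact WidePullback.lift (objs := fun _ : Fin n => P') (arrows := fun _ => f') s.snd
      (fun k => sq.lift (s.fst ≫ powOver.proj f n k) s.snd
        (by rw [Category.assoc, WidePullback.π_arrow]; exact s.condition))
      (fun k => sq.lift_snd _ _ _)
  · intro s
    apply WidePullback.hom_ext
    · intro k
      rw [Category.assoc, powOver_lift_proj_of_isPullback sq n, ← Category.assoc, WidePullback.lift_π, sq.lift_fst]
    · rw [Category.assoc, powOver_lift_base_of_isPullback sq n, ← Category.assoc, WidePullback.lift_base]
      exact s.condition.symm
  · intro s
    exact WidePullback.lift_base _ _ _ _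
  · intro s m hm₁ hm₂
    apply WidePullback.hom_ext
    · intro k
      rw [WidePullback.lift_π]
      apply sq.hom_ext
      · rw [Category.assoc, sq.lift_fst, ← powOver_lift_proj_of_isPullback sq n k, ← Category.assoc, hm₁]
      · rw [Category.assoc, sq.lift_snd, WidePullback.π_arrow]
        exact hm₂
    · rw [WidePullback.lift_base]
      exact hm₂

include sq in
/-- `∃`-packaged form of `isPullback_powOver_lift`. [cite: StacksProject, Tag 01JO] -/
theorem exists_isPullback_powOver_of_isPullback :
    ∃ c : powOver f' n ⟶ powOver f n,
      c ≫ powOver.base f n = powOver.base f' n ≫ b ∧ (∀ k, c ≫ powOver.proj f n k = powOver.proj f' n k ≫ b') ∧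
      IsPullback c (powOver.base f' n) (powOver.base f n) b :=
  ⟨_, powOver_lift_base_of_isPullback sq n, powOver_lift_proj_of_isPullback sq n, isPullback_powOver_lift sq n⟩

include sq in
/-- Points form over a cartesian square: two morphisms `T → (P′)ⁿ_{S′}` agree as soon as they agree after `base` and after each `pr_k ≫ b′`.
[cite: StacksProject, Tag 01JO] -/
theorem powOver_hom_ext_of_isPullback {T : Scheme.{u}} (g₁ g₂ : T ⟶ powOver f' n)
    (hbase : g₁ ≫ powOver.base f' n = g₂ ≫ powOver.base f' n)
    (hproj : ∀ k, g₁ ≫ powOver.proj f' n k ≫ b' = g₂ ≫ powOver.proj f' n k ≫ b') : g₁ = g₂ := by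
  apply WidePullback.hom_ext
  · intro k
    apply sq.hom_ext
    · simpa only [Category.assoc] using hproj k
    · rw [Category.assoc, Category.assoc, WidePullback.π_arrow]
      exact hbase
  · exact hbase

end Square

end Literature.AlgebraicGeometry.RelativeSpec

end
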